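import Summits.Ventures.Crystal3D.Theorems.StickyWulffConstantCoaxialWallLawEndRowDefs
import HarnessLib

/-!
# Definitions: the ROOT-CLASS BI-FAMILY LOCAL ROW — lane T's candidate named input (a2) for the pooled (β) plates side
# (lane T, crux `TextureLiminfV5`, stmt-Ventures-23912, registered stub `stub_terraceCensus`; cf-p1 RULING (ccxcviii) item (a2) «bi-family row at 9/2, or its
# ROOT-CLASS-ONLY weakening — the weakest sufficient input, preferred as the registered text when typed»; HOME/wall-p1-g23/BETA-PLATES-g23.md §5/§6)

HONEST FRAMING. Venture `Summits/Ventures/Crystal3D` (cell `crystal3d-full`), route `route-Ventures-StickyWulffConstant`, helper for the law-v5 crux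
`TextureLiminfV5` (stmt-Ventures-23912), lane T.  DEFINITIONS ONLY; NOTHING is asserted or proved; no census fact; F-C1 not moved.  A CANDIDATE text for the
planner (cf-p1 decides the registered form); typed now so that the discharge of the pooled plates side against it can be checked in the kernel.

WHY.  The (β) plates side pools the bottom plate's RISING hexagon lines (frame `G₁`, roots `inPlaneRoots G₁ 1`) and the top plate's FALLING hexagon lines
(frame `G₂`, roots `inPlaneRoots G₂ (−1)`) under ONE local row (`hexagon_twoPlate_sources_le_payers_cuts`, …LevelReachHexagonPooled); lane F's certificate of
record (`UnionCoreGradedCapWin₃`) is a SINGLE-coaxial-family row and does not cover a pair of unrelated grains (cf-p1 (ccxcviii)).  With the mover-exporting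
census chain (…LevelReachHexagonBarlowMover) every pooled end pair is a STRAIGHT ROOT-CLASS ending READ IN THE ROOT CLASS: `(b, b − G r)` with `b − G r`
FULL / NARROW / gliding in the frame `G` along `G r`, its own predecessor `b − 2·G r ∈ X`, and `b` not moving in `(G, G r)`.  So the weakest row that
discharges the pooled census counts exactly these events:
* `rootEndMult X v G RT b` — the number of roots `r ∈ RT` for which `b − G r ∈ X` is such a straight root-class mover onto `b` (explicit straight reading,
  predecessor clause (A) `b − G r − G r ∈ X`, `b` not moving in the class) — at most `#RT` (`≤ 3` for the rising / falling in-plane hexagon roots of a tilted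
  basal plane);
* **`RootPairRow v sF`** — for EVERY pair of frames `(G₁, G₂)`, every finite `1`-separated `X`, every payer `z ∈ X` of degree `≤ 11`:
  `Σ_{b ∈ X, dist z b ≤ 1, m b > 0} m b / pooledDef X b ≤ sF`, `m b = rootEndMult X v G₁ (inPlaneRoots G₁ 1) b + rootEndMult X v G₂ (inPlaneRoots G₂ (−1)) b`
  — verbatim the shape of lane F's `LocalEndRowA` with `endMultA` (all word classes of two plate systems) replaced by the root-class straight multiplicity of
  the two hexagon families; same pooled deficiency `pooledDef`, same payer condition.  Lane T needs the instance `sF = 9/2` (`v = WordVersion.v2`).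
RELATION TO LANE F: for a single family `rootEndMult ≤ endMultA` of the corresponding plate system (every counted root gives an `IsEndPairA` through the root
class), so `RootPairRow` restricted to one family is WEAKER than lane F's row; the bi-family sum is the new content (cross-family stacking of loads on one payer
sphere — the census object cf-p1 (ccxcviii) asks the 19481 / cf-p2 lineage to probe, «BIFAM-PROBE»).
WHAT THIS IS NOT: no claim that `RootPairRow v2 (9/2)` holds; not lane F's certificate; F-C1 not moved.
-/

noncomputable section

namespace Summit.Ventures.Crystal3D.Theorems

open Summit.Ventures.Crystal3D Finset
open scoped InnerProductSpace

open scoped Classical in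
/-- **ROOT-CLASS STRAIGHT-END MULTIPLICITY** of the ball `b` for the frame `G` and the root set `RT`: the number of roots `r ∈ RT` such that `q := b − G r ∈ X`
moves STRAIGHT onto `b` in the root class `(G, G r)` — `q` is FULL in `G`, or (version `v2`) NARROW along `G r`, or twin-reads a normal `m` with `⟪G r, m⟫ = 0`
(glide) — with its own predecessor `q − G r ∈ X` (clause (A)), while `b` is NOT moving in `(G, G r)`. -/
def rootEndMult (X : Finset (EuclideanSpace ℝ (Fin 3))) (v : WordVersion) (G : EuclideanSpace ℝ (Fin 3) ≃ₗᵢ[ℝ] EuclideanSpace ℝ (Fin 3))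
    (RT : Finset (EuclideanSpace ℝ (Fin 3))) (b : EuclideanSpace ℝ (Fin 3)) : ℕ :=
  (RT.filter fun r => b - G r ∈ X ∧ b - G r - G r ∈ X ∧
    (IsFull X G (b - G r) ∨ (v = WordVersion.v2 ∧ IsNarrow X G (G r) (b - G r)) ∨
      (∃ m, IsTwinReading X G m (b - G r) ∧ ⟪G r, m⟫_ℝ = 0)) ∧
    ¬ IsMoving X v G (G r) b).card

open scoped Classical in
/-- **THE ROOT-CLASS BI-FAMILY LOCAL ROW with constant `sF`** (lane T's candidate named input (a2)): for every pair of frames — family 1 the RISING in-plane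
hexagon roots of `G₁`, family 2 the FALLING in-plane hexagon roots of `G₂` — every finite `1`-separated configuration and every payer `z` of degree `≤ 11`, the
root-class straight ends within distance `1` of `z` load it by at most `sF` per unit of their pooled deficiency. -/
def RootPairRow (v : WordVersion) (sF : ℝ) : Prop :=
  ∀ (G₁ G₂ : EuclideanSpace ℝ (Fin 3) ≃ₗᵢ[ℝ] EuclideanSpace ℝ (Fin 3)) (X : Finset (EuclideanSpace ℝ (Fin 3))),
    (∀ p ∈ X, ∀ q ∈ X, p ≠ q → 1 ≤ dist p q) →
    ∀ z ∈ X, (X.filter fun q => dist z q = 1).card ≤ 11 →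
      ∑ b ∈ X.filter (fun b => dist z b ≤ 1 ∧ 0 < rootEndMult X v G₁ (inPlaneRoots G₁ 1) b + rootEndMult X v G₂ (inPlaneRoots G₂ (-1)) b),
        ((rootEndMult X v G₁ (inPlaneRoots G₁ 1) b + rootEndMult X v G₂ (inPlaneRoots G₂ (-1)) b : ℕ) : ℝ) / pooledDef X b ≤ sF

/-- Monotonicity of the row in its constant. -/
theorem rootPairRow_mono {v : WordVersion} {s s' : ℝ} (h : RootPairRow v s) (hs : s ≤ s') : RootPairRow v s' :=
  fun G₁ G₂ X hX z hz hdeg => (h G₁ G₂ X hX z hz hdeg).trans hs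

end Summit.Ventures.Crystal3D.Theorems

end
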